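import Mathlib.Tactic.Linarith
import Mathlib.Tactic.NormNum
import Mathlib.Tactic.FieldSimp
import Summits.Ventures.CertifiedManyBodySolver.Downfold.WorkedExamplePass

/-!
# The §14 worked-example PASS criteria, part 5: PASS-TV1 clause (c) on the H₃S BANDS OF RECORD, and the
# pass region it leaves for the next hand-in — stated in the kernel before that hand-in exists

Venture CertifiedManyBodySolver, cell `pub/hubbard-downfold`, seat hubbard-downfold-score-2 (session g14);
namespace `Summit.Ventures.CertifiedManyBodySolver.Downfold.WorkedExample` (objects of part 1, `WorkedExamplePass`,
REUSED: `Column`, `Column.counts`, `TV1`, `tv1`, `CellScore.inside`, `CellScore.tau`). Everything here is PROVED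
and finite; nothing is about a material or a method. Since RUN #117 of record (maps/run-2026-08-28q; every later
run through #137 reads identically on the nine) worked example 1 (M08 H₃S) reads, on both scorers of record and on
the regression layer `tv_criteria.py`: (a) ✓ · H-clean ✓ · (b) router AGREE ✓ · (d) ✓ · (e) verdict TP ✓ · **(c) ✗**
— PASS-TV1 FAILS ON CLAUSE (c) ALONE: the two banded pressure columns (hubbard-eph hand-in `eph.json` v2 of
2026-08-28T02:05Z: 150 GPa `[116.172, 277.997]` K, 200 GPa `[100.711, 353.185]` K; 100 GPa carries no band by design)
are each INSIDE the measured T_c ± τ but NEITHER is informative (relative half-width ≤ 1/4), so 0 of 3 columns count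
where (c) needs 2. The hand-in's own text calls both columns «PASS»; ACCEPTANCE §6.1 (c) does not, and this file is
the arithmetic of that difference, once, in closed form:

* §1 `Column.counts` in closed form: for a band with `0 < lo + hi`, the column COUNTS iff
  `lo − τ ≤ T_c ∧ T_c ≤ hi + τ ∧ 3·hi ≤ 5·lo` (`counts_iff`) — the relative-half-width clause is the RATIO clause
  `hi / lo ≤ 5/3`; hence the necessary edges `3 (T_c − τ) ≤ 5 lo` and `3 hi ≤ 5 (T_c + τ)` (`edges_of_counts`), and the
  two clauses pull in opposite directions: the ratio clause survives SHRINKING, INSIDE survives WIDENING, and a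
  sub-band of a counting band need not count (`counts_not_antitone`).
* §2 the bands of record: both INSIDE (`h3sRun117_inside`), both ratio-FAIL (833.991 > 580.86 and 1059.555 > 503.555,
  i.e. hi/lo ≈ 2.39 and 3.51 against 5/3; `h3sRun117_counts`), `nCounting = 0`, `tv1 = FAIL` with every other clause
  true (`h3sRun117_otherClauses`, `tv1_h3sRun117`) — «FAIL on (c) alone» as a theorem, = regression goldens S113/S103.
* §3 the PASS REGION left for the next hand-in, per column, on the truth of record (150 GPa 203 ± 8 K ⇒ τ = 10.15;
  200 GPa 180 ± 15 K ⇒ τ = 15): at 150 GPa a band counts iff `lo ≤ 213.15 ∧ 192.85 ≤ hi ∧ 3 hi ≤ 5 lo`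
  (`counts150_iff`); keeping the upper edge of record 277.997 K it counts iff `166.7982 ≤ lo ≤ 213.15`
  (`counts150_keep_hi_iff`); keeping the lower edge 116.172 K iff `192.85 ≤ hi ≤ 193.62` (`counts150_keep_lo_iff`).
  At 200 GPa a band counts iff `lo ≤ 195 ∧ 165 ≤ hi ∧ 3 hi ≤ 5 lo` (`counts200_iff`); NO band with the upper edge
  of record 353.185 K can count, whatever its lower edge (`counts200_keep_hi_false`: it would need lo ≥ 211.911 >
  195), every counting band there has `hi ≤ 325` (`counts200_hi_le`), and keeping the lower edge 100.711 K it
  counts iff `165 ≤ hi ≤ 167.8516…` (`counts200_keep_lo_iff`). With the 100-GPa column unbanded, PASS-TV1 needs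
  BOTH banded columns to count (`tv1_threeColumns_PASS_iff`).

WHAT THIS IS NOT: not a scorer of record (deputy-2 `score.py` c591238278228fac under ACCEPTANCE v1.9 and score-1
`phasemap.py` 1.9.2 are; this file re-derives their `inside` / `rel_half_width ≤ 0.25` columns in closed form),
not a statement about H₃S or about the e–ph band method (whose bands are SCREENING-GRADE / EXTRAPOLATED
intervals of record, quoted here as rationals and never endorsed), not a new threshold (1/4 and τ are ACCEPTANCE
§6.1 / §2.3 verbatim), and not a prediction that a narrower band is obtainable.
-/

namespace Summit.Ventures.CertifiedManyBodySolver.Downfold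

namespace WorkedExample

open CellScore

/-! ## §1 Clause (c) per column in closed form -/

/-- The relative-half-width clause `(hi − lo)/(hi + lo) ≤ 1/4` is the ratio clause `3·hi ≤ 5·lo` whenever
`0 < lo + hi` (every band of record has positive edges). [folklore] -/
theorem relHalfWidth_le_quarter_iff {lo hi : ℚ} (hpos : 0 < lo + hi) :
    (hi - lo) / (hi + lo) ≤ (1 : ℚ) / 4 ↔ 3 * hi ≤ 5 * lo := by
  have hpos' : 0 < hi + lo := by linarith
  rw [div_le_iff₀ hpos']
  constructor <;> intro h <;> linarith

/-- `Column.counts` in closed form: INSIDE (`lo − τ ≤ T_c ≤ hi + τ`) and the ratio clause `3·hi ≤ 5·lo`. [folklore] -/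
theorem counts_iff {lo hi Tc τ : ℚ} (hpos : 0 < lo + hi) :
    Column.counts ⟨some (lo, hi), Tc, τ⟩ = true ↔ lo - τ ≤ Tc ∧ Tc ≤ hi + τ ∧ 3 * hi ≤ 5 * lo := by
  show (CellScore.inside lo hi Tc τ && decide ((hi - lo) / (hi + lo) ≤ (1 : ℚ) / 4)) = true ↔ _
  rw [Bool.and_eq_true, decide_eq_true_iff, relHalfWidth_le_quarter_iff hpos]
  simp only [CellScore.inside, Bool.and_eq_true, decide_eq_true_iff]
  exact and_assoc

/-- The necessary EDGES of a counting band: `3 (T_c − τ) ≤ 5·lo` and `3·hi ≤ 5 (T_c + τ)` — a counting band sits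
inside `[0.6 (T_c − τ), 1.6̄ (T_c + τ)]`. [folklore] -/
theorem edges_of_counts {lo hi Tc τ : ℚ} (hpos : 0 < lo + hi)
    (h : Column.counts ⟨some (lo, hi), Tc, τ⟩ = true) : 3 * (Tc - τ) ≤ 5 * lo ∧ 3 * hi ≤ 5 * (Tc + τ) := by
  obtain ⟨h1, h2, h3⟩ := (counts_iff hpos).mp h
  constructor <;> linarith

/-- The ratio clause survives SHRINKING the band (raise `lo`, lower `hi`, edges staying positive). [folklore] -/
theorem ratio_of_shrink {lo hi lo' hi' : ℚ} (h : 3 * hi ≤ 5 * lo) (hlo : lo ≤ lo') (hhi : hi' ≤ hi) :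
    3 * hi' ≤ 5 * lo' := by linarith

/-- INSIDE survives WIDENING the band (lower `lo`, raise `hi`). [folklore] -/
theorem inside_of_widen {lo hi lo' hi' Tc τ : ℚ} (h : CellScore.inside lo hi Tc τ = true) (hlo : lo' ≤ lo)
    (hhi : hi ≤ hi') : CellScore.inside lo' hi' Tc τ = true := by
  simp only [CellScore.inside, Bool.and_eq_true, decide_eq_true_iff] at h ⊢
  obtain ⟨h1, h2⟩ := h
  constructor <;> linarith

/-- … so `counts` is neither monotone nor antitone in the band: a sub-band of a COUNTING band need not count
(it can lose INSIDE). Witness on the 150-GPa truth (203 K, τ = 10.15): `[170, 240]` counts, its sub-band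
`[170, 190]` does not (190 + 10.15 < 203). [folklore] -/
theorem counts_not_antitone :
    Column.counts ⟨some (170, 240), 203, 203 / 20⟩ = true ∧ Column.counts ⟨some (170, 190), 203, 203 / 20⟩ = false := by
  constructor <;> norm_num [Column.counts, CellScore.inside]

/-! ## §2 The H₃S bands of record (hubbard-eph `eph.json` v2, RUN #117 … of record) against the truth of record -/

/-- 150 GPa band of record `[116.172, 277.997]` K (cell(150) = hull(M_T, M_R), «PASS (Im-3m transfer)» in the
hand-in's words; screening-grade). [folklore] -/
def band150 : ℚ × ℚ := (116172 / 1000, 277997 / 1000)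

/-- 200 GPa band of record `[100.711, 353.185]` K («PASS, wide (w > 3)» in the hand-in's words; extrapolated). [folklore] -/
def band200 : ℚ × ℚ := (100711 / 1000, 353185 / 1000)

/-- The three TV1 columns as scored since RUN #117: 100 GPa unbanded (truth 150 ± 50 K, unscored by design),
150 GPa `band150` vs 203 K (τ = 203/20), 200 GPa `band200` vs 180 K (τ = 15). [folklore] -/
def h3sRun117Columns : List Column :=
  [⟨none, 150, 50⟩, ⟨some band150, 203, 203 / 20⟩, ⟨some band200, 180, 15⟩]

/-- Both banded columns are INSIDE (106.022 ≤ 203 ≤ 288.147; 85.711 ≤ 180 ≤ 368.185); the unbanded one is not. [folklore] -/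
theorem h3sRun117_inside : h3sRun117Columns.map Column.inside = [false, true, true] := by
  norm_num [h3sRun117Columns, band150, band200, Column.inside, CellScore.inside]

/-- The ratio clause FAILS on both bands of record: 3·277.997 = 833.991 > 580.86 = 5·116.172 and
3·353.185 = 1059.555 > 503.555 = 5·100.711 (relative half-widths ≈ 0.41 and 0.56 > 1/4). [folklore] -/
theorem h3sRun117_ratio_fails : ¬ 3 * band150.2 ≤ 5 * band150.1 ∧ ¬ 3 * band200.2 ≤ 5 * band200.1 := by
  norm_num [band150, band200]

/-- … hence NO column counts toward (c). [folklore] -/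
theorem h3sRun117_counts : h3sRun117Columns.map Column.counts = [false, false, false] := by
  norm_num [h3sRun117Columns, band150, band200, Column.counts, CellScore.inside]

/-- The H₃S material as scored since RUN #117: well-formed, H-clean, router AGREE, the columns above, no false
high-T_c («SC» cells only at T ≤ 100 K < 243.75 K), verdict TP. [folklore] -/
def h3sRun117 : TV1 := ⟨true, true, .AGREE, h3sRun117Columns, true, .TP⟩

/-- zero counting columns. [folklore] -/
theorem h3sRun117_nCounting : h3sRun117.nCounting = 0 := by
  simp only [TV1.nCounting, h3sRun117, List.countP_eq_length_filter]
  norm_num [h3sRun117Columns, band150, band200, Column.counts, CellScore.inside]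

/-- Every clause OTHER than (c) holds on the record. [folklore] -/
theorem h3sRun117_otherClauses : h3sRun117.wellFormed = true ∧ h3sRun117.hClean = true ∧
    h3sRun117.router = RouterScore.Outcome.AGREE ∧ h3sRun117.noFalseHighTc = true ∧ h3sRun117.kind = Kind.TP :=
  ⟨rfl, rfl, rfl, rfl, rfl⟩

/-- PASS-TV1 on the record = FAIL — by (c) alone (regression goldens S113 / S103: «PASS-TV1 FAIL (c)»). [folklore] -/
theorem tv1_h3sRun117 : tv1 h3sRun117 = .FAIL :=
  tv1_eq_FAIL_of_nCounting_le_one (by rw [h3sRun117_nCounting]; exact Nat.zero_le 1)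

/-- … and (c) is the ONLY obstruction: the same record with the columns replaced by any list with two counting
columns passes. [folklore] -/
theorem tv1_h3sRun117_withColumns {cols : List Column} (h : 2 ≤ cols.countP Column.counts) :
    tv1 { h3sRun117 with columns := cols } = .PASS := by
  rw [tv1_eq_PASS_iff, TV1.holds_iff]
  exact ⟨rfl, rfl, rfl, h, rfl, rfl⟩

/-! ## §3 The pass region per column on the truth of record (stated before the next hand-in) -/

/-- τ of record: 203/20 = 10.15 K at 150 GPa, 15 K at 200 GPa (§2.3; = `tau_h3s` of part 1). [folklore] -/
theorem tau_record : CellScore.tau 203 8 = 203 / 20 ∧ CellScore.tau 180 15 = 15 := ⟨tau_h3s.1, tau_h3s.2.1⟩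

/-- 150 GPa (T_c 203 K, τ 10.15): a band with positive edges counts iff `lo ≤ 213.15 ∧ 192.85 ≤ hi ∧ 3 hi ≤ 5 lo`. [folklore] -/
theorem counts150_iff {lo hi : ℚ} (hpos : 0 < lo + hi) :
    Column.counts ⟨some (lo, hi), 203, 203 / 20⟩ = true ↔ lo ≤ 4263 / 20 ∧ 3857 / 20 ≤ hi ∧ 3 * hi ≤ 5 * lo := by
  rw [counts_iff hpos]
  constructor
  · rintro ⟨h1, h2, h3⟩; exact ⟨by linarith, by linarith, h3⟩
  · rintro ⟨h1, h2, h3⟩; exact ⟨by linarith, by linarith, h3⟩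

/-- 150 GPa, keeping the UPPER edge of record 277.997 K: the column counts iff the lower edge rises into
`[166.7982, 213.15]` K (today 116.172). [folklore] -/
theorem counts150_keep_hi_iff {lo : ℚ} (hlo : 0 < lo) :
    Column.counts ⟨some (lo, band150.2), 203, 203 / 20⟩ = true ↔ 833991 / 5000 ≤ lo ∧ lo ≤ 4263 / 20 := by
  have e : band150.2 = 277997 / 1000 := rfl
  have hpos : 0 < lo + band150.2 := by rw [e]; linarith
  rw [counts150_iff hpos, e]
  constructor
  · rintro ⟨h1, -, h3⟩; exact ⟨by linarith, h1⟩
  · rintro ⟨h1, h2⟩; exact ⟨h2, by norm_num, by linarith⟩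

/-- 150 GPa, keeping the LOWER edge of record 116.172 K: the column counts iff the upper edge falls into the
sliver `[192.85, 193.62]` K (today 277.997). [folklore] -/
theorem counts150_keep_lo_iff {hi : ℚ} (hhi : 0 < hi) :
    Column.counts ⟨some (band150.1, hi), 203, 203 / 20⟩ = true ↔ 3857 / 20 ≤ hi ∧ hi ≤ 9681 / 50 := by
  have e : band150.1 = 116172 / 1000 := rfl
  have hpos : 0 < band150.1 + hi := by rw [e]; linarith
  rw [counts150_iff hpos, e]
  constructor
  · rintro ⟨-, h2, h3⟩; exact ⟨h2, by linarith⟩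
  · rintro ⟨h1, h2⟩; exact ⟨by norm_num, h1, by linarith⟩

/-- 200 GPa (T_c 180 K, τ 15): a band with positive edges counts iff `lo ≤ 195 ∧ 165 ≤ hi ∧ 3 hi ≤ 5 lo`. [folklore] -/
theorem counts200_iff {lo hi : ℚ} (hpos : 0 < lo + hi) :
    Column.counts ⟨some (lo, hi), 180, 15⟩ = true ↔ lo ≤ 195 ∧ 165 ≤ hi ∧ 3 * hi ≤ 5 * lo := by
  rw [counts_iff hpos]
  constructor
  · rintro ⟨h1, h2, h3⟩; exact ⟨by linarith, by linarith, h3⟩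
  · rintro ⟨h1, h2, h3⟩; exact ⟨by linarith, by linarith, h3⟩

/-- 200 GPa: every counting band has its upper edge at or below 325 K (= 5·195/3), whatever its lower edge. [folklore] -/
theorem counts200_hi_le {lo hi : ℚ} (hpos : 0 < lo + hi) (h : Column.counts ⟨some (lo, hi), 180, 15⟩ = true) :
    hi ≤ 325 := by
  obtain ⟨h1, -, h3⟩ := (counts200_iff hpos).mp h
  linarith

/-- 200 GPa, keeping the UPPER edge of record 353.185 K: NO lower edge makes the column count (it would need
`lo ≥ 211.911 > 195 = T_c + τ`) — the upper edge itself must come down. [folklore] -/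
theorem counts200_keep_hi_false {lo : ℚ} (hlo : 0 < lo) :
    Column.counts ⟨some (lo, band200.2), 180, 15⟩ = false := by
  have e : band200.2 = 353185 / 1000 := rfl
  have hpos : 0 < lo + band200.2 := by rw [e]; linarith
  rw [Bool.eq_false_iff]
  intro h
  have h325 := counts200_hi_le hpos h
  rw [e] at h325
  norm_num at h325

/-- 200 GPa, keeping the LOWER edge of record 100.711 K: the column counts iff the upper edge falls into
`[165, 167.8516…]` K (= 5·100.711/3; today 353.185). [folklore] -/
theorem counts200_keep_lo_iff {hi : ℚ} (hhi : 0 < hi) :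
    Column.counts ⟨some (band200.1, hi), 180, 15⟩ = true ↔ 165 ≤ hi ∧ hi ≤ 100711 / 600 := by
  have e : band200.1 = 100711 / 1000 := rfl
  have hpos : 0 < band200.1 + hi := by rw [e]; linarith
  rw [counts200_iff hpos, e]
  constructor
  · rintro ⟨-, h2, h3⟩; exact ⟨h2, by linarith⟩
  · rintro ⟨h1, h2⟩; exact ⟨by norm_num, h1, by linarith⟩

/-- A sample band inside the 150-GPa pass region: `[175, 260]` (ratio 780 ≤ 875; 164.85 ≤ 203 ≤ 270.15) counts;
and one inside the 200-GPa region: `[150, 240]` counts. (Existence of the regions, not a forecast.) [folklore] -/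
theorem passRegion_nonempty : Column.counts ⟨some (175, 260), 203, 203 / 20⟩ = true ∧
    Column.counts ⟨some (150, 240), 180, 15⟩ = true := by
  constructor <;> norm_num [Column.counts, CellScore.inside]

/-- With the 100-GPa column unbanded (no single-phase experimental interval; unscored by design), a three-column
TV1 record with every other clause true passes iff BOTH banded columns count. [folklore] -/
theorem tv1_threeColumns_PASS_iff (c150 c200 : Column) (Tc100 τ100 : ℚ) :
    tv1 ⟨true, true, .AGREE, [⟨none, Tc100, τ100⟩, c150, c200], true, .TP⟩ = .PASS ↔
      c150.counts = true ∧ c200.counts = true := by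
  rw [tv1_eq_PASS_iff, TV1.holds_iff]
  simp only [TV1.nCounting, List.countP_cons, List.countP_nil, true_and, and_true]
  have h0 : Column.counts ⟨none, Tc100, τ100⟩ = false := rfl
  rw [h0]
  cases h1 : c150.counts <;> cases h2 : c200.counts <;> simp

/-- … so on the truth of record the next H₃S hand-in passes (c) iff its 150-GPa band satisfies `counts150_iff`
AND its 200-GPa band satisfies `counts200_iff`; in particular its 200-GPa upper edge is ≤ 325 K and its 150-GPa
band has `hi/lo ≤ 5/3` (today 2.39). [folklore] -/
theorem tv1_next_handin_iff {lo₁ hi₁ lo₂ hi₂ : ℚ} (h₁ : 0 < lo₁ + hi₁) (h₂ : 0 < lo₂ + hi₂) :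
    tv1 ⟨true, true, .AGREE, [⟨none, 150, 50⟩, ⟨some (lo₁, hi₁), 203, 203 / 20⟩, ⟨some (lo₂, hi₂), 180, 15⟩], true, .TP⟩
        = .PASS ↔
      (lo₁ ≤ 4263 / 20 ∧ 3857 / 20 ≤ hi₁ ∧ 3 * hi₁ ≤ 5 * lo₁) ∧ (lo₂ ≤ 195 ∧ 165 ≤ hi₂ ∧ 3 * hi₂ ≤ 5 * lo₂) := by
  rw [tv1_threeColumns_PASS_iff, counts150_iff h₁, counts200_iff h₂]

end WorkedExample

end Summit.Ventures.CertifiedManyBodySolver.Downfold
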